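import Summits.ResolutionOfSingularities.ResolutionOfSingularities.Theorems.FrobeniusLadderFInjectiveMacaulayficationE8Char3BlowupStalksOffBadPoint
import Summits.ResolutionOfSingularities.ResolutionOfSingularities.Theorems.FrobeniusLadderFInjectiveMacaulayficationChartCertificatesCongr
import Summits.ResolutionOfSingularities.ResolutionOfSingularities.Theorems.FrobeniusLadderFInjectiveMacaulayficationAffineBlowupJacobsonNoetherian
import Summits.ResolutionOfSingularities.ResolutionOfSingularities.Theorems.FrobeniusLadderFInjectiveMacaulayficationFiModelOfPointCentre
import Summits.ResolutionOfSingularities.ResolutionOfSingularities.Theorems.FrobeniusLadderFInjectiveMacaulayficationE7Char3Charts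
import Summits.ResolutionOfSingularities.ResolutionOfSingularities.Theorems.FrobeniusLadderFInjectiveMacaulayficationCharPSections
import Summits.ResolutionOfSingularities.ResolutionOfSingularities.Theorems.FrobeniusLadderFInjectiveMacaulayficationProjBasicOpenSections
import Literature.AlgebraicGeometry.Resolution.AffineBlowupIntegral
import Literature.AlgebraicGeometry.Resolution.ComponentGluing
import Mathlib.Topology.JacobsonSpace
import HarnessLib

/-!
# Crux `FInjectiveMacaulayfication`: THE COMPLETE CHAR-3 TOWER `Bl_b Bl_𝔪 E₈⁰` (line `Sketch`, cycle 7, lead assembly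
`stub_e8Char3TowerFiModel`)

Support file for crux `stmt-ResolutionOfSingularities-15315` (`FrobeniusLadder.FInjectiveMacaulayfication`, route
`ResolutionOfSingularities/FrobeniusLadder`, rung 2), line `Sketch`.

For every field `k` of characteristic `3` the surface `E₈⁰ : X₂² + X₀³ + X₁⁵ = 0` is Cohen–Macaulay but not
F-injective at the origin, and ONE point blow-up does not repair it (`E8Char3NotFiModel`, p143112: the `y`-chart of
`X₁ = Bl_𝔪 E₈⁰` carries an `E₇⁰`-type point failing Fedder's test). This file certifies the TWO-STEP TOWER: blow up the
origin (`X₁ = affineBlowup 𝔪`, a non-affine scheme), then blow up the unique bad point `b` of `X₁` — the origin of the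
`y`-chart `A₁ ≅ k[X]/(g_y)`, `g_y = X₂² + X₁X₀³ + X₁³` — with the centre `𝔪_b` chosen on the chart `D₊(x̄₁t)` and
extended to a point-centre ideal sheaf. The pieces: the stalks of `X₁` off `b` are regular (`E8Char3BlowupStalksOffBadPoint`,
p153492); `b` is closed and is the zero locus of the moved centre (`ProjChartPointCentre`, p153224, over
`ProjBasicOpenSections`, p145175); the `E₇⁰` chart certificates (`E7Char3Charts`, p152126) move along
`k[X]/(g_y) ≅ A₁ ≅ Γ(X₁, D₊(x̄₁t))` (`StrictTransformChart`, `ChartCertificatesCongr`, p153200); the tower step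
(`FiModelOfPointCentre`, p152396) produces `X' → X₁` proper birational with the full clause at every stalk, and
composing with `affineBlowup.π` gives the crux's model of `Spec k[X]/(E₈⁰)`.

This is the first certified instance of the open core's conclusion reached by a genuine TOWER on a non-affine
intermediate model (compare the one-step models `Bl_𝔪 E₈⁰` in characteristic 5, p139106, and `Bl_𝔪 E₇⁰` in
characteristic 3, p145076). References: M. Artin, *Coverings of the rational double points in characteristic p* (1977)
(the forms `E₈⁰`, `E₇⁰`); R. Fedder, Trans. AMS 278 (1983), Thm. 1.12; The Stacks Project, Tags 0804, 02NS, 01J3. [folklore]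
-/

-- single-problem summit: the doubled namespace component is forced
set_option linter.dupNamespace false

noncomputable section

namespace Summit.ResolutionOfSingularities.ResolutionOfSingularities.Theorems.FInjectiveMacaulayfication.E8Char3TowerFiModel

open AlgebraicGeometry CategoryTheory Literature.AlgebraicGeometry.Resolution MvPolynomial

/-- `Γ(Spec R, ⊤)` has the characteristic of `R`. [folklore] -/
theorem charP_sections_spec_top (p : ℕ) (R : Type) [CommRing R] [CharP R p] :
    CharP Γ(Spec (.of R), ⊤) p :=
  (Scheme.ΓSpecIso (.of R)).commRingCatIsoToRingEquiv.toRingHom.charP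
    (Scheme.ΓSpecIso (.of R)).commRingCatIsoToRingEquiv.injective p

/-- The image of a span under a ring isomorphism composed pointwise: `span (range (ε ∘ x)) = (span (range x)).map ε`.
[folklore] -/
theorem span_range_comp_eq_map {A B : Type} [CommRing A] [CommRing B] (ε : A ≃+* B) {r : ℕ} (x : Fin r → A) :
    Ideal.span (Set.range fun i => ε (x i)) = Ideal.map ε (Ideal.span (Set.range x)) := by
  rw [Ideal.map_span, ← Set.range_comp]
  rfl

/-! ### The `Proj` chart dictionary in `σ`-generic form

`ProjBasicOpenSections.stub_projBasicOpenSections` (p145175) and `ProjChartPointCentre.stub_projChartPointCentre` (p153224)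
are stated for gradings `𝒜 : ℕ → Submodule R A` with `[CommRing A] [Algebra R A]`; instantiated at the Rees algebra, the
`Submodule` type then carries the module structure `Algebra.toModule (Subalgebra.algebra _)`, whereas `affineBlowup I =
Proj (reesGrading I)` and every hand-written `Proj (reesGrading I)` carry the subalgebra's own `Subalgebra.instModuleSubtypeMem`
— definitionally equal, but only after unfolding, which makes every unification between the two worlds cost ~10⁵ heartbeats.
The two lemmas are therefore restated here over Mathlib's `σ`-generic signature (`𝒜 : ℕ → σ`, `[SetLike σ A]
[AddSubgroupClass σ A] [GradedRing 𝒜]`), with the same proofs; instantiated at `reesGrading I` they are syntactically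
compatible with `affineBlowup I`. -/

/-- `D₊(f).toSpecΓ` factors as the chart isomorphism `D₊(f) ≅ Spec (A_f)₀` followed by `Spec` of the inverse of
`(A_f)₀ ≅ Γ(Proj A, D₊(f))` (`σ`-generic form of `ProjBasicOpenSections.isoSpec_hom_eq`). [cite: StacksProject, Tag 01MB] -/
theorem isoSpec_hom_eq_sigma {A σ : Type} [CommRing A] [SetLike σ A] [AddSubgroupClass σ A]
    (𝒜 : ℕ → σ) [GradedRing 𝒜] (f : A) {m : ℕ} (hf : f ∈ 𝒜 m) (hm : 0 < m) :
    (Proj.isAffineOpen_basicOpen 𝒜 f hf hm).isoSpec.hom =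
      (Proj.basicOpenIsoSpec 𝒜 f hf hm).hom ≫
        Spec.map (Proj.basicOpenIsoAway 𝒜 f hf hm).inv := by
  rw [IsAffineOpen.isoSpec_hom, Proj.basicOpenIsoSpec_hom, Proj.basicOpenToSpec,
    Category.assoc, ← Spec.map_comp, ← Proj.basicOpenIsoAway_hom 𝒜 f hf hm, Iso.inv_hom_id,
    Spec.map_id, Category.comp_id]

/-- **Sections of `Proj A` over `D₊(f)` versus the chart ring `(A_f)₀`** (`σ`-generic form of
`ProjBasicOpenSections.stub_projBasicOpenSections`, p145175): a ring isomorphism `e : Γ(Proj A, D₊(f)) ≃+* (A_f)₀` with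
`primeIdealOf (awayι q) = e⁻¹(q)` for every prime `q`. [cite: StacksProject, Tag 01MB] -/
theorem projBasicOpenSections_sigma {A σ : Type} [CommRing A] [SetLike σ A] [AddSubgroupClass σ A]
    (𝒜 : ℕ → σ) [GradedRing 𝒜] (f : A) {m : ℕ} (hf : f ∈ 𝒜 m) (hm : 0 < m) :
    ∃ e : Γ(Proj 𝒜, Proj.basicOpen 𝒜 f) ≃+* HomogeneousLocalization.Away 𝒜 f,
      ∀ (y : Proj.basicOpen 𝒜 f) (q : PrimeSpectrum (HomogeneousLocalization.Away 𝒜 f)),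
        (Proj.awayι 𝒜 f hf hm).base q = y.1 →
        ((Proj.isAffineOpen_basicOpen 𝒜 f hf hm).primeIdealOf y).asIdeal = q.asIdeal.comap e.toRingHom := by
  refine ⟨(Proj.basicOpenIsoAway 𝒜 f hf hm).symm.commRingCatIsoToRingEquiv, fun y q hq => ?_⟩
  -- the point `y` of `D₊(f)` is the image of `q` under the chart isomorphism
  have hy : y = (Proj.basicOpenIsoSpec 𝒜 f hf hm).inv q := by
    apply Subtype.ext
    rw [← hq, ← Proj.basicOpenIsoSpec_inv_ι, Scheme.Hom.comp_apply, Scheme.Opens.ι_apply]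
  -- hence `primeIdealOf y = toSpecΓ (basicOpenIsoSpec.inv q) = Spec (awayToSection⁻¹) q`
  have key : (Proj.isAffineOpen_basicOpen 𝒜 f hf hm).primeIdealOf y =
      Spec.map (Proj.basicOpenIsoAway 𝒜 f hf hm).inv q := by
    rw [IsAffineOpen.primeIdealOf, hy, isoSpec_hom_eq_sigma, Scheme.Hom.comp_apply,
      Scheme.inv_hom_apply]
  rw [key, Spec.map_apply]
  rfl

/-- **A closed point of one chart of `Proj A` as a centre** (`σ`-generic form of
`ProjChartPointCentre.stub_projChartPointCentre`, p153224): for `e : Γ(Proj A, D₊(f)) ≃+* (A_f)₀` compatible with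
`primeIdealOf` and a maximal ideal `q₀` of `(A_f)₀`, the point `b = awayι q₀` lies in `D₊(f)`; for `y ∈ D₊(f)`,
`e⁻¹(q₀) ≤ 𝔭_y` iff `y = b`; and `b` is closed when `Proj A` is a Jacobson space. [cite: StacksProject, Tag 01J3] -/
theorem projChartPointCentre_sigma {A σ : Type} [CommRing A] [SetLike σ A] [AddSubgroupClass σ A]
    (𝒜 : ℕ → σ) [GradedRing 𝒜] (f : A) {m : ℕ} (hf : f ∈ 𝒜 m) (hm : 0 < m)
    (e : Γ(Proj 𝒜, Proj.basicOpen 𝒜 f) ≃+* HomogeneousLocalization.Away 𝒜 f)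
    (he : ∀ (y : Proj.basicOpen 𝒜 f) (q : PrimeSpectrum (HomogeneousLocalization.Away 𝒜 f)),
        (Proj.awayι 𝒜 f hf hm).base q = y.1 →
        ((Proj.isAffineOpen_basicOpen 𝒜 f hf hm).primeIdealOf y).asIdeal = q.asIdeal.comap e.toRingHom)
    (q₀ : PrimeSpectrum (HomogeneousLocalization.Away 𝒜 f)) (hq₀ : q₀.asIdeal.IsMaximal) :
    (Proj.awayι 𝒜 f hf hm).base q₀ ∈ Proj.basicOpen 𝒜 f ∧
      (∀ (y : Proj 𝒜) (hy : y ∈ Proj.basicOpen 𝒜 f),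
        Ideal.comap e.toRingHom q₀.asIdeal ≤
            ((Proj.isAffineOpen_basicOpen 𝒜 f hf hm).primeIdealOf ⟨y, hy⟩).asIdeal ↔
          y = (Proj.awayι 𝒜 f hf hm).base q₀) ∧
      (JacobsonSpace ↥(Proj 𝒜) → IsClosed ({(Proj.awayι 𝒜 f hf hm).base q₀} : Set ↥(Proj 𝒜))) := by
  have hrange := Proj.opensRange_awayι 𝒜 f hf hm
  refine ⟨?_, fun y hy => ?_, fun hJ => ?_⟩
  · rw [← hrange]
    exact ⟨q₀, rfl⟩
  · -- write `y = awayι q`; then `primeIdealOf y = e⁻¹(q)` by the compatibility hypothesis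
    have hy' : y ∈ (Proj.awayι 𝒜 f hf hm).opensRange := by rwa [hrange]
    obtain ⟨q, rfl⟩ := hy'
    rw [he ⟨_, hy⟩ q rfl, Ideal.comap_le_comap_iff_of_surjective e.toRingHom e.surjective]
    constructor
    · -- `q₀ ≤ q` with `q₀` maximal and `q` proper forces `q = q₀`
      intro h
      rw [PrimeSpectrum.ext (hq₀.eq_of_le q.isPrime.ne_top h).symm]
    · -- `awayι` is injective
      intro h
      rw [(Proj.awayι 𝒜 f hf hm).isOpenEmbedding.injective h]
  · -- `{q₀}` is closed in `Spec (A_f)₀`, and the open embedding `awayι` into the Jacobson space `Proj A` pulls the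
    -- closed points of `Proj A` back to exactly the closed points of the chart
    have hq₀' : q₀ ∈ closedPoints (PrimeSpectrum (HomogeneousLocalization.Away 𝒜 f)) :=
      (PrimeSpectrum.isClosed_singleton_iff_isMaximal q₀).mpr hq₀
    have hpre : q₀ ∈ (Proj.awayι 𝒜 f hf hm).base ⁻¹' closedPoints ↥(Proj 𝒜) := by
      rw [(Proj.awayι 𝒜 f hf hm).isOpenEmbedding.preimage_closedPoints]
      exact hq₀'
    exact hpre

/-- The tower step `FiModelOfPointCentre.stub_fiModelOfPointCentre` with the affine open given as an open `U` plus a proof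
`hU : IsAffineOpen U` (instead of an element of `affineOpens`) — the form in which the `Proj` chart lemmas deliver their data;
stated over an abstract scheme so that instantiating it at `Proj` costs no unfolding. [folklore] -/
theorem fiModelOfPointCentre_opens (p : ℕ) [Fact p.Prime] (X₁ : Scheme.{0}) [IsIntegral X₁] [IsLocallyNoetherian X₁]
    (b : X₁) (hb : IsClosed ({b} : Set X₁)) (U : X₁.Opens) (hU : IsAffineOpen U) (hbU : b ∈ U)
    (I : Ideal Γ(X₁, U)) (hI0 : I ≠ ⊥)
    (hzero : ∀ (x : X₁) (hx : x ∈ U), I ≤ (hU.primeIdealOf ⟨x, hx⟩).asIdeal ↔ x = b)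
    (hchar : ∀ V : X₁.affineOpens, ((V : X₁.Opens) : Set X₁).Nonempty → CharP Γ(X₁, V) p)
    (hoff : ∀ x : X₁, x ≠ b →
      IsDomain (X₁.presheaf.stalk x) ∧ ∀ d : ℕ, ringKrullDim (X₁.presheaf.stalk x) = d →
        ∀ s : Fin d → X₁.presheaf.stalk x, (Ideal.span (Set.range s)).radical.IsMaximal →
          RingTheory.Sequence.IsWeaklyRegular (X₁.presheaf.stalk x) (List.ofFn s) ∧
          ∀ y : X₁.presheaf.stalk x, (∃ e : ℕ, y ^ p ^ e ∈ Ideal.span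
            ((fun z : X₁.presheaf.stalk x => z ^ p ^ e) ''
              (Ideal.span (Set.range s) : Set (X₁.presheaf.stalk x)))) → y ∈ Ideal.span (Set.range s))
    (hon : ∃ (r : ℕ) (x : Fin r → Γ(X₁, U)) (hxI : ∀ i, x i ∈ I), Ideal.span (Set.range x) = I ∧
        ∀ (i : Fin r), x i ≠ 0 →
          ∀ (Q : Ideal (HomogeneousLocalization.Away (reesGrading I) (reesT (x i) (hxI i)))) [Q.IsMaximal],
          reesChartBase (x i) (hxI i) (x i) ∈ Q →
          ∀ d : ℕ, ringKrullDim (Localization.AtPrime Q) = d → ∀ s : Fin d → Localization.AtPrime Q,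
            (Ideal.span (Set.range s)).radical.IsMaximal →
              RingTheory.Sequence.IsWeaklyRegular (Localization.AtPrime Q) (List.ofFn s) ∧
              ∀ y : Localization.AtPrime Q, (∃ e : ℕ, y ^ p ^ e ∈ Ideal.span
                ((fun z : Localization.AtPrime Q => z ^ p ^ e) ''
                  (Ideal.span (Set.range s) : Set (Localization.AtPrime Q)))) → y ∈ Ideal.span (Set.range s)) :
    ∃ (X' : Scheme.{0}) (π : X' ⟶ X₁), IsProper π ∧ Literature.AlgebraicGeometry.Resolution.IsBirational π ∧
      IsIntegral X' ∧
      ∀ x : X', IsDomain (X'.presheaf.stalk x) ∧ ∀ d : ℕ, ringKrullDim (X'.presheaf.stalk x) = d →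
        ∀ s : Fin d → X'.presheaf.stalk x, (Ideal.span (Set.range s)).radical.IsMaximal →
          RingTheory.Sequence.IsWeaklyRegular (X'.presheaf.stalk x) (List.ofFn s) ∧
          ∀ z : X'.presheaf.stalk x, (∃ e : ℕ, z ^ p ^ e ∈
              Ideal.span ((fun w : X'.presheaf.stalk x => w ^ p ^ e) ''
                (Ideal.span (Set.range s) : Set (X'.presheaf.stalk x)))) →
            z ∈ Ideal.span (Set.range s) :=
  FiModelOfPointCentre.stub_fiModelOfPointCentre p X₁ b hb ⟨U, hU⟩ hbU I hI0 hzero hchar hoff hon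

/-- Moving a centre along two ring isomorphisms: if `q = d(J')` and `J = J'` then `(d ≫ esec⁻¹)(J) = esec⁻¹(q)` — stated over
abstract rings so that the chart-ring instance paths never meet the unifier. [folklore] -/
theorem map_trans_symm_eq_comap {A B C : Type} [CommRing A] [CommRing B] [CommRing C] (d : A ≃+* B) (esec : C ≃+* B)
    (J J' : Ideal A) (hJ : J = J') (q : Ideal B) (hq : q = Ideal.map d J') :
    Ideal.map (d.trans esec.symm) J = Ideal.comap esec.toRingHom q := by
  subst hJ
  subst hq
  apply le_antisymm
  · rw [Ideal.map_le_iff_le_comap]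
    intro a ha
    rw [Ideal.mem_comap, Ideal.mem_comap]
    have e1 : esec.toRingHom ((d.trans esec.symm) a) = d a := by simp
    rw [e1]
    exact Ideal.mem_map_of_mem _ ha
  · intro z hz
    rw [Ideal.mem_comap, ← Ideal.comap_symm, Ideal.mem_comap] at hz
    have e2 : z = (d.trans esec.symm) (d.symm (esec.toRingHom z)) := by simp
    rw [e2]
    exact Ideal.mem_map_of_mem _ hz

-- budget: the chart-ring types make every unification step on this proof expensive (cf. `E7Char3FiModel`)
set_option maxHeartbeats 800000 in
/-- **THE COMPLETE CHAR-3 TOWER**: for every field `k` of characteristic `3`, `Spec k[X]/(X₂²+X₀³+X₁⁵)` admits a proper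
birational model all of whose stalks are domains with every system of parameters weakly regular and every parameter ideal
Frobenius closed — the blow-up of the unique bad point of `Bl_𝔪 E₈⁰`, composed with `Bl_𝔪 E₈⁰ → E₈⁰`. [folklore] -/
theorem e8Char3TowerFiModel (k : Type) [Field k] [CharP k 3] (f : MvPolynomial (Fin 3) k)
    (hf : f = MvPolynomial.X 2 ^ 2 + MvPolynomial.X 0 ^ 3 + MvPolynomial.X 1 ^ 5) :
    ∃ (X' : Scheme.{0}) (π : X' ⟶ Spec (.of (MvPolynomial (Fin 3) k ⧸ Ideal.span {f}))), IsProper π ∧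
      Literature.AlgebraicGeometry.Resolution.IsBirational π ∧
      ∀ y : X', IsDomain (X'.presheaf.stalk y) ∧ ∀ d : ℕ, ringKrullDim (X'.presheaf.stalk y) = d →
        ∀ s : Fin d → X'.presheaf.stalk y, (Ideal.span (Set.range s)).radical.IsMaximal →
          RingTheory.Sequence.IsWeaklyRegular (X'.presheaf.stalk y) (List.ofFn s) ∧
          ∀ z : X'.presheaf.stalk y, (∃ e : ℕ, z ^ 3 ^ e ∈
              Ideal.span ((fun w : X'.presheaf.stalk y => w ^ 3 ^ e) ''
                (Ideal.span (Set.range s) : Set (X'.presheaf.stalk y)))) →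
            z ∈ Ideal.span (Set.range s) := by
  haveI : Fact (Nat.Prime 3) := ⟨Nat.prime_three⟩
  -- the forms: `f` prime and non-zero, the strict transform `gy` prime, the chart identity `θ₁ f = X₁² gy`
  have hgyex : ∃ gy : MvPolynomial (Fin 3) k,
      gy = MvPolynomial.X 2 ^ 2 + MvPolynomial.X 1 * MvPolynomial.X 0 ^ 3 + MvPolynomial.X 1 ^ 3 := ⟨_, rfl⟩
  obtain ⟨gy, hgy⟩ := hgyex
  have hforms := E8Forms.stub_e8Forms k f
    (MvPolynomial.X 2 ^ 2 + MvPolynomial.X 0 + MvPolynomial.X 0 ^ 3 * MvPolynomial.X 1 ^ 5) gy hf rfl hgy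
  obtain ⟨⟨hfprime, hf0, hX0f⟩, -, ⟨hgyprime, hX1gy, hθy⟩⟩ := hforms
  haveI := hfprime
  haveI := hgyprime
  -- `R = k[X]/(f)`: a finitely generated Noetherian domain of characteristic 3; `k[X]/(gy)` likewise
  haveI : IsDomain (MvPolynomial (Fin 3) k ⧸ Ideal.span {f}) := Ideal.Quotient.isDomain _
  haveI : CharP (MvPolynomial (Fin 3) k ⧸ Ideal.span {f}) 3 :=
    CharP.of_ringHom_of_ne_zero (algebraMap k (MvPolynomial (Fin 3) k ⧸ Ideal.span {f})) 3 (by decide)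
  -- the first centre `𝔪 = (x̄₀, x̄₁, x̄₂) ≠ 0` (generators kept opaque)
  have hxex : ∃ x : Fin 3 → MvPolynomial (Fin 3) k ⧸ Ideal.span {f},
      x = fun j : Fin 3 => Ideal.Quotient.mk (Ideal.span {f}) (MvPolynomial.X j) := ⟨_, rfl⟩
  obtain ⟨x, hx⟩ := hxex
  have hI : Ideal.span (Set.range x) ≠ ⊥ := by
    intro hbot
    have hx0 : x 0 ∈ Ideal.span (Set.range x) := Ideal.subset_span (Set.mem_range_self 0)
    rw [hbot, Ideal.mem_bot, hx] at hx0
    exact hX0f (Ideal.Quotient.eq_zero_iff_mem.mp hx0)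
  -- the intermediate model `X₁ = Bl_𝔪 E₈⁰`: integral, Jacobson, locally Noetherian
  haveI hint : IsIntegral (affineBlowup (Ideal.span (Set.range x))) := affineBlowup.isIntegral hI
  have hJN := AffineBlowupJacobsonNoetherian.stub_affineBlowupJacobsonNoetherian k
    (MvPolynomial (Fin 3) k ⧸ Ideal.span {f}) (Ideal.span (Set.range x))
  obtain ⟨hJac, hLN⟩ := hJN
  haveI := hJac
  haveI := hLN
  -- the `y`-chart: `d : k[X]/(gy) ≃ A₁` and the section isomorphism `esec : Γ(X₁, D₊(x̄₁t)) ≃ A₁`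
  have hdex := StrictTransformChart.stub_strictTransformChart k f gy 1 2 hfprime hf0 hgyprime hX1gy hθy x hx
  obtain ⟨d, -⟩ := hdex
  have hesec := projBasicOpenSections_sigma (reesGrading (Ideal.span (Set.range x)))
    (reesT (x 1) (Ideal.subset_span (Set.mem_range_self 1)))
    (reesT_mem (x 1) (Ideal.subset_span (Set.mem_range_self 1))) Nat.one_pos
  obtain ⟨esec, hesec⟩ := hesec
  -- the origin of the `y`-chart: `𝔪_gy = (X̄₀, X̄₁, X̄₂)` maximal in `k[X]/(gy)`, `q₀ = d(𝔪_gy)` maximal in `A₁`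
  haveI hPmax := Fedder.isMaximal_span_range_X k 3
  have hker : RingHom.ker (Ideal.Quotient.mk (Ideal.span {gy})) ≤
      Ideal.span (Set.range (MvPolynomial.X : Fin 3 → MvPolynomial (Fin 3) k)) := by
    rw [Ideal.mk_ker, Ideal.span_singleton_le_iff_mem, hgy]
    exact (E8ChartYPoints.gy_mem_and_ne_zero k).1
  obtain ⟨h𝔪max, -⟩ := BlowupFiModel.isMaximal_map_and_comap_map_of_surjective
    (Ideal.Quotient.mk (Ideal.span {gy})) Ideal.Quotient.mk_surjective
    (Ideal.span (Set.range (MvPolynomial.X : Fin 3 → MvPolynomial (Fin 3) k))) hker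
  haveI := h𝔪max
  haveI hq₀max : (Ideal.map d (Ideal.map (Ideal.Quotient.mk (Ideal.span {gy}))
      (Ideal.span (Set.range (MvPolynomial.X : Fin 3 → MvPolynomial (Fin 3) k))))).IsMaximal :=
    Ideal.map_isMaximal_of_equiv d
  -- `q₀` as a point of `Spec A₁`, `b = awayι₁ q₀`
  have hq₀ex : ∃ q₀ : PrimeSpectrum (HomogeneousLocalization.Away (reesGrading (Ideal.span (Set.range x)))
      (reesT (x 1) (Ideal.subset_span (Set.mem_range_self 1)))),
      q₀.asIdeal = Ideal.map d (Ideal.map (Ideal.Quotient.mk (Ideal.span {gy}))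
        (Ideal.span (Set.range (MvPolynomial.X : Fin 3 → MvPolynomial (Fin 3) k)))) :=
    ⟨⟨_, hq₀max.isPrime⟩, rfl⟩
  obtain ⟨q₀, hq₀⟩ := hq₀ex
  have hq₀max' : q₀.asIdeal.IsMaximal := by rw [hq₀]; exact hq₀max
  -- W2-C: `b ∈ D₊(x̄₁t)`, the zero locus of `esec⁻¹(q₀)` is `{b}`, `b` is closed
  have hC := projChartPointCentre_sigma (reesGrading (Ideal.span (Set.range x)))
    (reesT (x 1) (Ideal.subset_span (Set.mem_range_self 1)))
    (reesT_mem (x 1) (Ideal.subset_span (Set.mem_range_self 1))) Nat.one_pos esec hesec q₀ hq₀max'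
  obtain ⟨hbU, hzero, hclosed⟩ := hC
  have hb := hclosed hJac
  -- the second centre on `U = D₊(x̄₁t)`, moved along `ε = d ≫ esec⁻¹ : k[X]/(gy) ≃ Γ(X₁, U)`
  have hxgex : ∃ xg : Fin 3 → MvPolynomial (Fin 3) k ⧸ Ideal.span {gy},
      xg = fun j : Fin 3 => Ideal.Quotient.mk (Ideal.span {gy}) (MvPolynomial.X j) := ⟨_, rfl⟩
  obtain ⟨xg, hxg⟩ := hxgex
  have hspan_xg : Ideal.span (Set.range xg) = Ideal.map (Ideal.Quotient.mk (Ideal.span {gy}))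
      (Ideal.span (Set.range (MvPolynomial.X : Fin 3 → MvPolynomial (Fin 3) k))) := by
    rw [Ideal.map_span, ← Set.range_comp, hxg]
    rfl
  have hJ0 : Ideal.span (Set.range xg) ≠ ⊥ := by
    intro hbot
    have hx1 : xg 1 ∈ Ideal.span (Set.range xg) := Ideal.subset_span (Set.mem_range_self 1)
    rw [hbot, Ideal.mem_bot, hxg] at hx1
    exact hX1gy (Ideal.Quotient.eq_zero_iff_mem.mp hx1)
  have hIeq := map_trans_symm_eq_comap d esec (Ideal.span (Set.range xg)) _ hspan_xg q₀.asIdeal hq₀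
  -- the certified charts of `(k[X]/(gy), 𝔪_gy)` (T6), moved along `ε` (W2-B)
  have hcerts := E7Char3Charts.stub_e7Char3Charts k gy hgy xg hxg
  have hxI' : ∀ i : Fin 3, (d.trans esec.symm) (xg i) ∈
      Ideal.map (d.trans esec.symm) (Ideal.span (Set.range xg)) :=
    fun i => Ideal.mem_map_of_mem _ (Ideal.subset_span (Set.mem_range_self i))
  have hcerts' := ChartCertificatesCongr.stub_chartCertificatesCongr 3 (MvPolynomial (Fin 3) k ⧸ Ideal.span {gy})
    _ (d.trans esec.symm) (Ideal.span (Set.range xg)) 3 xg (fun i => Ideal.subset_span (Set.mem_range_self i))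
    hxI' hcerts
  -- the zero locus of `I = ε(𝔪_gy) = esec⁻¹(q₀)` in `U` is `{b}` (transitivity of `≤` along `hIeq`, no rewriting)
  have hzero' : ∀ (y : ↥(Proj (reesGrading (Ideal.span (Set.range x)))))
      (hy : y ∈ Proj.basicOpen (reesGrading (Ideal.span (Set.range x)))
        (reesT (x 1) (Ideal.subset_span (Set.mem_range_self 1)))),
      Ideal.map (d.trans esec.symm) (Ideal.span (Set.range xg)) ≤
          ((Proj.isAffineOpen_basicOpen (reesGrading (Ideal.span (Set.range x)))
            (reesT (x 1) (Ideal.subset_span (Set.mem_range_self 1)))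
            (reesT_mem (x 1) (Ideal.subset_span (Set.mem_range_self 1))) Nat.one_pos).primeIdealOf ⟨y, hy⟩).asIdeal ↔
        y = (Proj.awayι (reesGrading (Ideal.span (Set.range x))) (reesT (x 1) (Ideal.subset_span (Set.mem_range_self 1)))
          (reesT_mem (x 1) (Ideal.subset_span (Set.mem_range_self 1))) Nat.one_pos).base q₀ :=
    fun y hy => ⟨fun h => (hzero y hy).1 (hIeq.ge.trans h), fun h => hIeq.le.trans ((hzero y hy).2 h)⟩
  -- THE TOWER STEP at `b` with centre `I` on `U = D₊(x̄₁t)`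
  have hstep := fiModelOfPointCentre_opens 3 (affineBlowup (Ideal.span (Set.range x)))
    ((Proj.awayι (reesGrading (Ideal.span (Set.range x))) (reesT (x 1) (Ideal.subset_span (Set.mem_range_self 1)))
      (reesT_mem (x 1) (Ideal.subset_span (Set.mem_range_self 1))) Nat.one_pos).base q₀) hb
    (Proj.basicOpen (reesGrading (Ideal.span (Set.range x))) (reesT (x 1) (Ideal.subset_span (Set.mem_range_self 1))))
    (Proj.isAffineOpen_basicOpen _ _ (reesT_mem (x 1) (Ideal.subset_span (Set.mem_range_self 1))) Nat.one_pos)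
    hbU (Ideal.map (d.trans esec.symm) (Ideal.span (Set.range xg))) ?_ hzero' ?_ ?_ ?_
  · obtain ⟨X', π', hπ', hbir', -, hgood⟩ := hstep
    haveI := hπ'
    exact ⟨X', π' ≫ affineBlowup.π (Ideal.span (Set.range x)), inferInstance,
      Literature.AlgebraicGeometry.Resolution.ComponentGluing.IsBirational.comp hbir' (affineBlowup.isBirational hI),
      hgood⟩
  · -- `I ≠ 0`: `𝔪_gy ∋ X̄₁ ≠ 0` and `ε` is injective
    rw [Ne, Ideal.map_eq_bot_iff_of_injective (d.trans esec.symm).injective]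
    exact hJ0
  · -- every non-empty affine open of `X₁` has characteristic 3
    intro V hV
    exact CharPSections.stub_charP_sections 3 (affineBlowup (Ideal.span (Set.range x))) _
      (affineBlowup.π (Ideal.span (Set.range x))) (charP_sections_spec_top 3 _) V hV
  · -- the stalks of `X₁` off `b` satisfy the clause
    intro y hy
    exact E8Char3BlowupStalksOffBadPoint.stub_e8Char3BlowupStalksOffBadPoint k f gy hf hgy x hx d q₀ hq₀ y hy
  · -- the certified charts of the moved centre
    refine ⟨3, fun j => (d.trans esec.symm) (xg j), hxI', span_range_comp_eq_map _ xg, ?_⟩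
    intro i hi
    exact hcerts' i hi

/-- **THE COMPLETE CHAR-3 TOWER, registered form** (lead stub `stub_e8Char3TowerFiModel` of crux
stmt-ResolutionOfSingularities-15315, line `Sketch`, cycle 7): `= e8Char3TowerFiModel`. [folklore] -/
theorem stub_e8Char3TowerFiModel : ∀ (k : Type) [Field k] [CharP k 3] (f : MvPolynomial (Fin 3) k),
    f = MvPolynomial.X 2 ^ 2 + MvPolynomial.X 0 ^ 3 + MvPolynomial.X 1 ^ 5 →
    ∃ (X' : Scheme.{0}) (π : X' ⟶ Spec (.of (MvPolynomial (Fin 3) k ⧸ Ideal.span {f}))), IsProper π ∧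
      Literature.AlgebraicGeometry.Resolution.IsBirational π ∧
      ∀ y : X', IsDomain (X'.presheaf.stalk y) ∧ ∀ d : ℕ, ringKrullDim (X'.presheaf.stalk y) = d →
        ∀ s : Fin d → X'.presheaf.stalk y, (Ideal.span (Set.range s)).radical.IsMaximal →
          RingTheory.Sequence.IsWeaklyRegular (X'.presheaf.stalk y) (List.ofFn s) ∧
          ∀ z : X'.presheaf.stalk y, (∃ e : ℕ, z ^ 3 ^ e ∈
              Ideal.span ((fun w : X'.presheaf.stalk y => w ^ 3 ^ e) ''
                (Ideal.span (Set.range s) : Set (X'.presheaf.stalk y)))) →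
            z ∈ Ideal.span (Set.range s) :=
  fun k _ _ f hf => e8Char3TowerFiModel k f hf

end Summit.ResolutionOfSingularities.ResolutionOfSingularities.Theorems.FInjectiveMacaulayfication.E8Char3TowerFiModel

end
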